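import Summits.QuantumFields.BalabanUV.Beta.EriceRemainderEnclosureHistoryAutonomyThreshold

/-!
# EriceRemainderEnclosureHistoryAutonomyThresholdWellPosed — (E38b) WELL-POSEDNESS OF THE FLOW WITH MEMORY UNDER THE SHARP CONSTANT
# `M·γ < 3√3·b`: stability (Lipschitz dependence on pin and functional, uniformly in the scale), uniqueness, existence by scale-wise Picard
# iteration and `∃!` — node U2's `T4BetaFlowWellPosed` §4 ∕ (E37b)'s `_zm` chain ∕ (E37h)'s `_zc` chain VERBATIM with the contraction constant
# `q = M·γ∕(3√3·b)` of (E38a) `…HistoryAutonomyThreshold` (`picard_contraction_zs`) — the largest box on which the zeroth moment alone makes the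
# AUTONOMY row's intrinsic characterisation well-posed: `γ < 3√3·b∕M` ((E37b): `γ < b∕M`; (E37h): `γ < 5b∕(2M)`); sharp by (E38a)∕(E38c)

Cell `pub-balaban`, β-function sub-cell, BINDER row D4 «RemainderConst leaves for Bałaban's split» (`HOME/BINDER-OWNERS.md`; owner
lineage `b2b-balaban-beta-an4`; this file by co-owner #2 lineage `b2b-balaban-beta-d4-p2`, generation 40), β-FLOW TEAM duty (1),
FREEZE (0) honoured (def-free; node U2's `MemFlow` ∕ `picard` ∕ `iterate` ∕ `solution` ∕ `le_of_affine_contraction` and (E37b)'s `le_picard_zm` ∕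
`lower_le_upper_zm` BY NAME).  Imports (E38a) only.

HONEST FRAMING (page 1, verbatim and binding).  *"Discharging BetaPertH makes Bałaban's UV stability UNCONDITIONAL — a real
constructive-QFT result; it is NOT the continuum limit and NOT the Clay problem."*  THIS FILE DISCHARGES NOTHING OF THE KIND.  Pure real
analysis about an ABSTRACT functional with displayed zeroth moment and floor — hypotheses, not facts; nothing of Bałaban's (1.22) or its limit
functional is asserted.  Row D4 class UNCHANGED (critical-path width 0; instance 0∕1; D4 DISCHARGE NO DATE).  HONEST DEPENDENCY: continuum YM
on T⁴ ⇐ BetaPertH ∧ nine spine estimates (0/9 proved); BetaPertH ⇐ (D1) ∧ (D4) ∧ CAP+tail; G-an2-4 gates asym, D1 and NE2/3/4.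

WHAT IS PROVED ([folklore]; 0 `def`, 0 sorry).  **`memFlow_stability_zs`** (`|h m − h′ m| ≤ (γ³∕2·|1∕gIR² − 1∕gIR′²| + (γ∕(3√3b))·η)∕(1 − q)`),
**`memFlow_unique_zs`**, `memFlow_eq_of_functional_agree_zs`, `abs_iterate_succ_sub_le_zs`, `tendsto_iterate_zs`, `abs_iterate_sub_solution_le_zs`,
`solution_seqBox_zs`, `picard_solution_zs`, **`memFlow_solution_zs`**, **`existsUnique_memFlow_zs`**, `eq_solution_of_memFlow_zs`.
-/

noncomputable section
open Filter Topology Finset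

namespace Summit.QuantumFields.BalabanUV.Beta.EriceRemainderEnclosureHistoryAutonomyThresholdWellPosed

open Literature.MathematicalPhysics.QuantumFieldTheory.Balaban1983to89
open Literature.MathematicalPhysics.QuantumFieldTheory.Balaban1983to89.T4ContinuumCoupling (tendsto_of_abs_sub_le_geom)
open Literature.MathematicalPhysics.QuantumFieldTheory.Balaban1983to89.T4BetaStationary
open Literature.MathematicalPhysics.QuantumFieldTheory.Balaban1983to89.T4BetaFlowWellPosed
open Summit.QuantumFields.BalabanUV.Beta.EriceRemainderEnclosureHistoryAutonomyWellPosed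
open Summit.QuantumFields.BalabanUV.Beta.EriceRemainderEnclosureHistoryAutonomyThreshold

variable {B B' : (ℕ → ℝ) → ℝ} {M γ b η gIR gIR' : ℝ} {h h' : ℕ → ℝ}

/-! ## §1 Well-posedness under `M·γ < 3√3·b` -/

/-- **STABILITY, SHARP**: `B` (zeroth moment `M`, floor `b`), `B′` (floor `b`, within `η` of `B`), `M·γ < 3√3·b`: a box solution of `(B, gIR)` and
any box solution of `(B′, gIR′)` satisfy `|h m − h′ m| ≤ (γ³∕2·|1∕gIR² − 1∕gIR′²| + (γ∕(3√3b))·η)∕(1 − M·γ∕(3√3b))` at every scale. [folklore] -/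
theorem memFlow_stability_zs
    (hB : ∀ u u' : ℕ → ℝ, SeqBox γ u → SeqBox γ u' → ∀ D : ℝ, (∀ j, |u j - u' j| ≤ D) → |B u - B u'| ≤ M * D)
    (hM : 0 ≤ M) (hgIR : 0 < gIR) (hgIRγ : gIR ≤ γ) (hgIR' : 0 < gIR') (hgIR'γ : gIR' ≤ γ) (hb : 0 < b)
    (hlo : ∀ u, SeqBox γ u → b ≤ B u) (hlo' : ∀ u, SeqBox γ u → b ≤ B' u) (hsmall : M * γ < 3 * Real.sqrt 3 * b)
    (hη : ∀ u, SeqBox γ u → |B u - B' u| ≤ η) (hh : SeqBox γ h) (hh' : SeqBox γ h') (hf : MemFlow B gIR h)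
    (hf' : MemFlow B' gIR' h') (m : ℕ) :
    |h m - h' m| ≤ (γ ^ 3 / 2 * |1 / gIR ^ 2 - 1 / gIR' ^ 2| + γ / (3 * Real.sqrt 3 * b) * η)
      / (1 - M * γ / (3 * Real.sqrt 3 * b)) := by
  have hγ : 0 < γ := lt_of_lt_of_le hgIR hgIRγ
  have hη0 : 0 ≤ η := (abs_nonneg _).trans (hη _ (seqBox_const hγ))
  obtain ⟨hq0, hq1⟩ := contraction_const_zs hM hγ.le hb hsmall
  refine le_of_affine_contraction (δ := fun i => |h i - h' i|) hq0 hq1 (by positivity)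
    (fun i => abs_sub_le_of_seqBox hh hh' i) (fun D hD i => ?_) m
  have hfix := picard_eq_of_memFlow hf (fun m => (hh m).1)
  have := abs_picard_sub_le_core_zs hB hM hgIR hgIRγ hgIR' hgIR'γ hb hlo hlo' hη hh hh' hD i (hh' i).1
    (invSq_eq_of_memFlow hf' i)
  rw [hfix] at this
  linarith

/-- **UNIQUENESS UNDER `M·γ < 3√3·b`** (the closed form `≤` is (E38a)'s `memFlow_unique_zs_closed`). [folklore] -/
theorem memFlow_unique_zs
    (hB : ∀ u u' : ℕ → ℝ, SeqBox γ u → SeqBox γ u' → ∀ D : ℝ, (∀ j, |u j - u' j| ≤ D) → |B u - B u'| ≤ M * D)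
    (hM : 0 ≤ M) (hgIR : 0 < gIR) (hgIRγ : gIR ≤ γ) (hb : 0 < b) (hlo : ∀ u, SeqBox γ u → b ≤ B u)
    (hsmall : M * γ < 3 * Real.sqrt 3 * b) (hh : SeqBox γ h) (hh' : SeqBox γ h') (hf : MemFlow B gIR h)
    (hf' : MemFlow B gIR h') : h = h' := by
  funext m
  have := memFlow_stability_zs hB hM hgIR hgIRγ hgIR hgIRγ hb hlo hlo hsmall
    (fun u _ => by simp : ∀ u, SeqBox γ u → |B u - B u| ≤ 0) hh hh' hf hf' m
  simp only [sub_self, abs_zero, mul_zero, zero_add, zero_div] at this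
  exact eq_of_abs_sub_nonpos this

/-- UNIVERSALITY under `M·γ < 3√3·b`: two functionals with floor `b` that agree on the box generate the same box solution. [folklore] -/
theorem memFlow_eq_of_functional_agree_zs
    (hB : ∀ u u' : ℕ → ℝ, SeqBox γ u → SeqBox γ u' → ∀ D : ℝ, (∀ j, |u j - u' j| ≤ D) → |B u - B u'| ≤ M * D)
    (hM : 0 ≤ M) (hgIR : 0 < gIR) (hgIRγ : gIR ≤ γ) (hb : 0 < b) (hlo : ∀ u, SeqBox γ u → b ≤ B u)
    (hsmall : M * γ < 3 * Real.sqrt 3 * b) (hagree : ∀ u, SeqBox γ u → B u = B' u) (hh : SeqBox γ h)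
    (hh' : SeqBox γ h') (hf : MemFlow B gIR h) (hf' : MemFlow B' gIR h') : h = h' := by
  funext m
  have hlo' : ∀ u, SeqBox γ u → b ≤ B' u := fun u hu => hagree u hu ▸ hlo u hu
  have h0 : ∀ u, SeqBox γ u → |B u - B' u| ≤ 0 := fun u hu => by simp [hagree u hu]
  have := memFlow_stability_zs hB hM hgIR hgIRγ hgIR hgIRγ hb hlo hlo' hsmall h0 hh hh' hf hf' m
  simp only [sub_self, abs_zero, mul_zero, zero_add, zero_div] at this
  exact eq_of_abs_sub_nonpos this

/-- Consecutive Picard iterates are `γ·qⁿ`-close, `q = M·γ∕(3√3·b)`. [folklore] -/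
theorem abs_iterate_succ_sub_le_zs
    (hB : ∀ u u' : ℕ → ℝ, SeqBox γ u → SeqBox γ u' → ∀ D : ℝ, (∀ j, |u j - u' j| ≤ D) → |B u - B u'| ≤ M * D)
    (hM : 0 ≤ M) (hgIR : 0 < gIR) (hgIRγ : gIR ≤ γ) (hb : 0 < b) (hlo : ∀ u, SeqBox γ u → b ≤ B u) :
    ∀ n m, |iterate B gIR (n + 1) m - iterate B gIR n m| ≤ γ * (M * γ / (3 * Real.sqrt 3 * b)) ^ n := by
  intro n
  induction n with
  | zero =>
    intro m
    simpa using abs_sub_le_of_seqBox (iterate_seqBox hgIR hgIRγ hb hlo 1) (iterate_seqBox hgIR hgIRγ hb hlo 0) m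
  | succ n ih =>
    intro m
    have := picard_contraction_zs hB hM hgIR hgIRγ hb hlo (iterate_seqBox hgIR hgIRγ hb hlo (n + 1))
      (iterate_seqBox hgIR hgIRγ hb hlo n) ih m
    calc |iterate B gIR (n + 1 + 1) m - iterate B gIR (n + 1) m|
        = |picard B gIR (iterate B gIR (n + 1)) m - picard B gIR (iterate B gIR n) m| := rfl
      _ ≤ M * γ / (3 * Real.sqrt 3 * b) * (γ * (M * γ / (3 * Real.sqrt 3 * b)) ^ n) := this
      _ = γ * (M * γ / (3 * Real.sqrt 3 * b)) ^ (n + 1) := by ring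

/-- The iterates converge scale-wise. [folklore] -/
theorem tendsto_iterate_zs
    (hB : ∀ u u' : ℕ → ℝ, SeqBox γ u → SeqBox γ u' → ∀ D : ℝ, (∀ j, |u j - u' j| ≤ D) → |B u - B u'| ≤ M * D)
    (hM : 0 ≤ M) (hgIR : 0 < gIR) (hgIRγ : gIR ≤ γ) (hb : 0 < b) (hlo : ∀ u, SeqBox γ u → b ≤ B u)
    (hsmall : M * γ < 3 * Real.sqrt 3 * b) (m : ℕ) :
    Tendsto (fun n => iterate B gIR n m) atTop (𝓝 (solution B gIR m)) := by
  have hq1 := (contraction_const_zs hM (hgIR.le.trans hgIRγ) hb hsmall).2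
  have hc : CauchySeq fun n => iterate B gIR n m := by
    refine cauchySeq_of_le_geometric (M * γ / (3 * Real.sqrt 3 * b)) γ hq1 fun n => ?_
    rw [Real.dist_eq, abs_sub_comm]
    exact abs_iterate_succ_sub_le_zs hB hM hgIR hgIRγ hb hlo n m
  exact tendsto_nhds_limUnder (cauchySeq_tendsto_of_complete hc)

/-- Geometric rate of the scale-wise convergence. [folklore] -/
theorem abs_iterate_sub_solution_le_zs
    (hB : ∀ u u' : ℕ → ℝ, SeqBox γ u → SeqBox γ u' → ∀ D : ℝ, (∀ j, |u j - u' j| ≤ D) → |B u - B u'| ≤ M * D)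
    (hM : 0 ≤ M) (hgIR : 0 < gIR) (hgIRγ : gIR ≤ γ) (hb : 0 < b) (hlo : ∀ u, SeqBox γ u → b ≤ B u)
    (hsmall : M * γ < 3 * Real.sqrt 3 * b) (n m : ℕ) :
    |iterate B gIR n m - solution B gIR m|
      ≤ γ * (M * γ / (3 * Real.sqrt 3 * b)) ^ n / (1 - M * γ / (3 * Real.sqrt 3 * b)) := by
  have hq1 := (contraction_const_zs hM (hgIR.le.trans hgIRγ) hb hsmall).2
  have h := dist_le_of_le_geometric_of_tendsto (M * γ / (3 * Real.sqrt 3 * b)) γ hq1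
    (fun n => by
      rw [Real.dist_eq, abs_sub_comm]
      exact abs_iterate_succ_sub_le_zs hB hM hgIR hgIRγ hb hlo n m)
    (tendsto_iterate_zs hB hM hgIR hgIRγ hb hlo hsmall m) n
  rwa [Real.dist_eq] at h

/-- The scale-wise limit is box-valued. [folklore] -/
theorem solution_seqBox_zs
    (hB : ∀ u u' : ℕ → ℝ, SeqBox γ u → SeqBox γ u' → ∀ D : ℝ, (∀ j, |u j - u' j| ≤ D) → |B u - B u'| ≤ M * D)
    (hM : 0 ≤ M) (hgIR : 0 < gIR) (hgIRγ : gIR ≤ γ) (hb : 0 < b) (hlo : ∀ u, SeqBox γ u → b ≤ B u)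
    (hsmall : M * γ < 3 * Real.sqrt 3 * b) : SeqBox γ (solution B gIR) := by
  have hγ : 0 < γ := lt_of_lt_of_le hgIR hgIRγ
  intro m
  have ht := tendsto_iterate_zs hB hM hgIR hgIRγ hb hlo hsmall m
  have hup : b ≤ B (fun _ => γ) + M * γ := lower_le_upper_zm hM hγ hlo
  have hbb : 0 < 1 / gIR ^ 2 + (m : ℝ) * (B (fun _ => γ) + M * γ) := by
    have : 0 ≤ (m : ℝ) * (B (fun _ => γ) + M * γ) := mul_nonneg (Nat.cast_nonneg m) (hb.le.trans hup)
    positivity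
  have hlow : ∀ n, 1 / Real.sqrt (1 / gIR ^ 2 + (m : ℝ) * (B (fun _ => γ) + M * γ)) ≤ iterate B gIR n m := by
    intro n
    cases n with
    | zero =>
      simp only [iterate_zero]
      refine one_div_sqrt_le hgIR (le_add_of_nonneg_right ?_)
      exact mul_nonneg (Nat.cast_nonneg m) (hb.le.trans hup)
    | succ n =>
      exact le_picard_zm hB hγ hgIR hb hlo (iterate_seqBox hgIR hgIRγ hb hlo n) m
  refine ⟨lt_of_lt_of_le (one_div_pos.mpr (Real.sqrt_pos.mpr hbb)) (ge_of_tendsto' ht hlow), ?_⟩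
  exact le_of_tendsto' ht fun n => (iterate_seqBox hgIR hgIRγ hb hlo n m).2

/-- The limit is a fixed point of the solution map. [folklore] -/
theorem picard_solution_zs
    (hB : ∀ u u' : ℕ → ℝ, SeqBox γ u → SeqBox γ u' → ∀ D : ℝ, (∀ j, |u j - u' j| ≤ D) → |B u - B u'| ≤ M * D)
    (hM : 0 ≤ M) (hgIR : 0 < gIR) (hgIRγ : gIR ≤ γ) (hb : 0 < b) (hlo : ∀ u, SeqBox γ u → b ≤ B u)
    (hsmall : M * γ < 3 * Real.sqrt 3 * b) : picard B gIR (solution B gIR) = solution B gIR := by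
  have hγ : 0 < γ := lt_of_lt_of_le hgIR hgIRγ
  set q := M * γ / (3 * Real.sqrt 3 * b) with hq
  obtain ⟨hq0, hq1⟩ := contraction_const_zs hM hγ.le hb hsmall
  have hsol := solution_seqBox_zs hB hM hgIR hgIRγ hb hlo hsmall
  funext m
  have h1 : Tendsto (fun n => iterate B gIR (n + 1) m) atTop (𝓝 (picard B gIR (solution B gIR) m)) := by
    refine tendsto_of_abs_sub_le_geom (c := q * (γ / (1 - q))) hq0 hq1 fun n => ?_
    have hD : ∀ i, |iterate B gIR n i - solution B gIR i| ≤ γ * q ^ n / (1 - q) := fun i =>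
      abs_iterate_sub_solution_le_zs hB hM hgIR hgIRγ hb hlo hsmall n i
    have := picard_contraction_zs hB hM hgIR hgIRγ hb hlo (iterate_seqBox hgIR hgIRγ hb hlo n) hsol hD m
    calc |iterate B gIR (n + 1) m - picard B gIR (solution B gIR) m|
        = |picard B gIR (iterate B gIR n) m - picard B gIR (solution B gIR) m| := rfl
      _ ≤ q * (γ * q ^ n / (1 - q)) := this
      _ = q * (γ / (1 - q)) * q ^ n := by ring
  have h2 : Tendsto (fun n => iterate B gIR (n + 1) m) atTop (𝓝 (solution B gIR m)) :=
    (tendsto_iterate_zs hB hM hgIR hgIRγ hb hlo hsmall m).comp (tendsto_add_atTop_nat 1)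
  exact tendsto_nhds_unique h1 h2

/-- **EXISTENCE UNDER `M·γ < 3√3·b`**. [folklore] -/
theorem memFlow_solution_zs
    (hB : ∀ u u' : ℕ → ℝ, SeqBox γ u → SeqBox γ u' → ∀ D : ℝ, (∀ j, |u j - u' j| ≤ D) → |B u - B u'| ≤ M * D)
    (hM : 0 ≤ M) (hgIR : 0 < gIR) (hgIRγ : gIR ≤ γ) (hb : 0 < b) (hlo : ∀ u, SeqBox γ u → b ≤ B u)
    (hsmall : M * γ < 3 * Real.sqrt 3 * b) : MemFlow B gIR (solution B gIR) :=
  memFlow_of_picard_eq hgIR hb hlo (solution_seqBox_zs hB hM hgIR hgIRγ hb hlo hsmall)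
    (picard_solution_zs hB hM hgIR hgIRγ hb hlo hsmall)

/-- **WELL-POSEDNESS UNDER `M·γ < 3√3·b`**: exactly one box solution per pin `gIR ∈ ]0,γ]`. [folklore] -/
theorem existsUnique_memFlow_zs
    (hB : ∀ u u' : ℕ → ℝ, SeqBox γ u → SeqBox γ u' → ∀ D : ℝ, (∀ j, |u j - u' j| ≤ D) → |B u - B u'| ≤ M * D)
    (hM : 0 ≤ M) (hgIR : 0 < gIR) (hgIRγ : gIR ≤ γ) (hb : 0 < b) (hlo : ∀ u, SeqBox γ u → b ≤ B u)
    (hsmall : M * γ < 3 * Real.sqrt 3 * b) : ∃! h : ℕ → ℝ, SeqBox γ h ∧ MemFlow B gIR h :=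
  ⟨solution B gIR, ⟨solution_seqBox_zs hB hM hgIR hgIRγ hb hlo hsmall, memFlow_solution_zs hB hM hgIR hgIRγ hb hlo hsmall⟩,
    fun _ hh => memFlow_unique_zs hB hM hgIR hgIRγ hb hlo hsmall hh.1 (solution_seqBox_zs hB hM hgIR hgIRγ hb hlo hsmall)
      hh.2 (memFlow_solution_zs hB hM hgIR hgIRγ hb hlo hsmall)⟩

/-- Any box solution IS the constructed one (under `M·γ < 3√3·b`). [folklore] -/
theorem eq_solution_of_memFlow_zs
    (hB : ∀ u u' : ℕ → ℝ, SeqBox γ u → SeqBox γ u' → ∀ D : ℝ, (∀ j, |u j - u' j| ≤ D) → |B u - B u'| ≤ M * D)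
    (hM : 0 ≤ M) (hgIR : 0 < gIR) (hgIRγ : gIR ≤ γ) (hb : 0 < b) (hlo : ∀ u, SeqBox γ u → b ≤ B u)
    (hsmall : M * γ < 3 * Real.sqrt 3 * b) (hh : SeqBox γ h) (hf : MemFlow B gIR h) : h = solution B gIR :=
  memFlow_unique_zs hB hM hgIR hgIRγ hb hlo hsmall hh (solution_seqBox_zs hB hM hgIR hgIRγ hb hlo hsmall) hf
    (memFlow_solution_zs hB hM hgIR hgIRγ hb hlo hsmall)

end Summit.QuantumFields.BalabanUV.Beta.EriceRemainderEnclosureHistoryAutonomyThresholdWellPosed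

end
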